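import Mathlib

/-!
# T5ComplexOrientation — the complex orientation is well defined

Tier-5 support of seat p6 (Hodge-theoretic side of N1, cell pub-hodge-repro2): the orientation
conventions H1 / H4 of route/T5-N1-hodge-p6.md («the complex orientation», Voisin Ch. 3) and
the clause «positively oriented» in the first sentence of the proof of Lemma H2.1.

For a complex vector space `E` with a ℂ-basis `b : ι → E`, the real frame
`(0, k) ↦ b k`, `(1, k) ↦ I • b k` is an ℝ-basis (Mathlib `Module.Basis.smulTower` of
`Complex.basisOneI` and `b`).  The orientation of `E` (as a real space) defined by this ℝ-basis
does not depend on the ℂ-basis `b`: the change of basis between two such real frames is the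
restriction of scalars of a ℂ-linear automorphism `φ`, whose real determinant is
`Algebra.norm ℝ (det_ℂ φ) = normSq (det_ℂ φ) > 0` (Mathlib `LinearMap.det_restrictScalars`,
`Algebra.norm_complex_apply`, `Module.Basis.orientation_eq_iff_det_pos`).  This is the
«complex orientation», the one for which `∫_S α ∧ ᾱ > 0` (H3 / H4); the unitary frames of
`T5UnitaryCoframe` are among these real frames.  Linear algebra only.
-/

namespace Summit.Ventures.HodgeRepro2.T5ComplexOrientation

open Module

variable {E : Type*} [AddCommGroup E] [Module ℂ E] [Module ℝ E] [IsScalarTower ℝ ℂ E]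
  {ι : Type*}

/-- The real basis `e_k, I e_k` attached to a ℂ-basis `b`: index `(0, k) ↦ b k`,
`(1, k) ↦ I • b k` (`Complex.basisOneI.smulTower b`). -/
noncomputable def realBasis (b : Basis ι ℂ E) : Basis (Fin 2 × ι) ℝ E :=
  Complex.basisOneI.smulTower b

/-- `realBasis b (s, k) = basisOneI s • b k`. -/
theorem realBasis_apply (b : Basis ι ℂ E) (p : Fin 2 × ι) :
    realBasis b p = Complex.basisOneI p.1 • b p.2 :=
  Basis.smulTower_apply _ _ _

/-- `realBasis b (0, k) = b k`. -/
theorem realBasis_zero (b : Basis ι ℂ E) (k : ι) : realBasis b (0, k) = b k := by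
  simp [realBasis_apply, Complex.coe_basisOneI]

/-- `realBasis b (1, k) = I • b k`. -/
theorem realBasis_one (b : Basis ι ℂ E) (k : ι) : realBasis b (1, k) = Complex.I • b k := by
  simp [realBasis_apply, Complex.coe_basisOneI]

/-- The real frame of `b'` is the image of the real frame of `b` under the ℂ-linear change of
basis `φ = b.equiv b'`, restricted to ℝ. -/
theorem realBasis_eq_comp (b b' : Basis ι ℂ E) :
    ⇑(realBasis b') =
      ((b.equiv b' (Equiv.refl ι) : E →ₗ[ℂ] E).restrictScalars ℝ) ∘ ⇑(realBasis b) := by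
  funext p
  simp only [Function.comp_apply, realBasis_apply, LinearMap.restrictScalars_apply,
    LinearEquiv.coe_coe, map_smul, Basis.equiv_apply, Equiv.refl_apply]

section Finite

variable [Fintype ι] [DecidableEq ι]

/-- The real determinant of the change of basis between two real frames is the complex norm
`normSq (det_ℂ φ)` of the complex determinant of `φ = b.equiv b'`. -/
theorem det_realBasis (b b' : Basis ι ℂ E) :
    (realBasis b).det (realBasis b') =
      Complex.normSq (LinearMap.det (b.equiv b' (Equiv.refl ι) : E →ₗ[ℂ] E)) := by
  rw [realBasis_eq_comp b b', Basis.det_comp, Basis.det_self, mul_one,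
    LinearMap.det_restrictScalars, Algebra.norm_complex_apply]

/-- The real determinant of the change of basis between two real frames is positive. -/
theorem det_realBasis_pos (b b' : Basis ι ℂ E) : 0 < (realBasis b).det (realBasis b') := by
  rw [det_realBasis]
  exact Complex.normSq_pos.mpr (b.equiv b' (Equiv.refl ι)).isUnit_det'.ne_zero

/-- **The complex orientation is well defined.** Any two ℂ-bases of `E` induce the same
orientation of the underlying real vector space through their real frames. -/
theorem orientation_realBasis_eq (b b' : Basis ι ℂ E) :
    (realBasis b).orientation = (realBasis b').orientation :=
  (Basis.orientation_eq_iff_det_pos _ _).mpr (det_realBasis_pos b b')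

/-- The complex orientation of `E`, defined through any ℂ-basis `b` (independent of `b` by
`orientation_realBasis_eq`). -/
noncomputable def complexOrientation (b : Basis ι ℂ E) : Orientation ℝ E (Fin 2 × ι) :=
  (realBasis b).orientation

/-- `complexOrientation` does not depend on the chosen ℂ-basis. -/
theorem complexOrientation_eq (b b' : Basis ι ℂ E) :
    complexOrientation b = complexOrientation b' :=
  orientation_realBasis_eq b b'

/-- The real frame of every ℂ-basis is positively oriented for the complex orientation:
H2.1's «positively oriented» for the frame `e₁, Ie₁, e₂, Ie₂` of any ℂ-basis `e₁, e₂`. -/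
theorem realBasis_orientation_eq_complexOrientation (b b' : Basis ι ℂ E) :
    (realBasis b').orientation = complexOrientation b :=
  (orientation_realBasis_eq b b').symm

end Finite

end Summit.Ventures.HodgeRepro2.T5ComplexOrientation
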